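import Mathlib
import HarnessLib
import Summits.HubbardSuperconductivity.HubbardSuperconductivity.Theorems.KLProgrammePolarRayCoarea
import Literature.MathematicalPhysics.QuantumLattice.HubbardFermiRadiusBandSmooth

/-!
# Route `KLProgramme` — crux K3 split, ENGINE child (`KLRegimeEngineV7` stmt-HubbardSuperconductivity-19662 and its gen-3 successor):
# the polar-ray / level coordinates INSTANTIATED ON THE SQUARE-LATTICE BAND — `∫ d²k` over the tube `|ε(k) − μ| < ē` of the bare Fermi
# curve as `∫ dθ ∫ de 𝒥(θ,e) h(u_{μ+e}(θ)·dir θ)` with the tree's band Fermi radius `u_ν(θ) = bandFermiRadius ν θ` and the explicit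
# Jacobian `𝒥(θ,e) = u_{μ+e}(θ)/∂_tε(θ, u_{μ+e}(θ))` (cell gate-hubbard-kl, seat hubbard-kl-k3c2-p2 «thermal-bar induction n ≤ nScales β + 1»)

`…PolarRayCoarea` (`klry_integral_eq_polar_ray`) is abstract in the ray reparametrisation `ρ(θ, ·)`.  Here `ρ(θ, e) := u_{μ+e}(θ)`, the
polar radius of the level curve `{ε = μ + e}` of `ε(k) = −2(cos k₁ + cos k₂)` (`bandFermiRadius`, `…HubbardFermiRadiusBand`), whose level
derivative is `∂_e u_{μ+e}(θ) = 1/∂_tε(θ, u)` (`hasDerivAt_bandFermiRadius_level`, `…HubbardFermiRadiusBandSmooth`) — so for every continuous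
compactly supported `h` on the plane, supported in the open square `(−π,π)²` and in the tube `|ε − μ| < ē` (`0 ≤ ē`, `−4 < μ − ē`, `μ + ē < 0`):

  `∫ h = ∫_{θ ∈ (−π,π)} ∫_{e ∈ −ē..ē} (u_{μ+e}(θ)·(∂_tε(θ,u_{μ+e}(θ)))⁻¹) • h(u_{μ+e}(θ) cos θ, u_{μ+e}(θ) sin θ) de dθ`
  (`klry_integral_eq_band_level_coords`), and for RADIAL integrands `h(t·dir θ) = H θ (ε(t·dir θ) − μ)`:
  `∫ h = ∫_θ ∫_{e ∈ −ē..ē} 𝒥(θ,e) • H θ e` (`klry_integral_eq_band_level_coords_radial`).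

This is the bare-frame (`K = 0`) carrier of the engine; the frame version replaces `u_ν` by the root selection of the frame's curve
(`perturbedFermiRadius`, p4 lineage) and needs only its level derivative in the same shape.  Pure analysis on the tree's band objects.
References: BGM 2006 §2.5 (2.56b)–(2.56e) (coordinates `(θ, e)` and the Jacobian of the level sets); HOME/p1/E2-NOTE.md §1.
-/

noncomputable section

namespace Summit.HubbardSuperconductivity.HubbardSuperconductivity.Theorems.KLRegimeSplit

set_option linter.dupNamespace false -- summit = problem name (single-conjunct summit), D-0017

open Real Set MeasureTheory intervalIntegral Literature.MathematicalPhysics.QuantumLattice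

variable {E : Type*} [NormedAddCommGroup E] [NormedSpace ℝ E]

/-- Along a ray from `Γ`, the band value at `(t cos θ, t sin θ)` is the tree's `rayDispersion (θ, t)`. -/
theorem klry_sqDispersion_ray (θ t : ℝ) : sqDispersion ![t * Real.cos θ, t * Real.sin θ] = rayDispersion (θ, t) := by
  rw [rayDispersion_eq]
  simp [sqDispersion]

/-- A point `(t cos θ, t sin θ)` of the open square `(−π,π)²` with `t ≥ 0` has `t` in the monotonicity interval `[0, π/‖dir θ‖]` of the ray. -/
theorem klry_mem_Icc_exit {θ t : ℝ} (ht : 0 ≤ t) (h1 : |t * Real.cos θ| < π) (h2 : |t * Real.sin θ| < π) :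
    t ∈ Icc 0 (π / ‖dir θ‖) := by
  refine ⟨ht, ?_⟩
  rw [le_div_iff₀ (norm_dir_pos θ), norm_dir]
  rw [abs_mul, abs_of_nonneg ht] at h1 h2
  rcases le_total |Real.cos θ| |Real.sin θ| with hcs | hcs
  · rw [max_eq_right hcs]; exact h2.le
  · rw [max_eq_left hcs]; exact h1.le

omit [NormedSpace ℝ E] in
/-- **Ray support from tube support**: if `h` lives in the open square and in the tube `|ε − μ| < ē` (`0 ≤ ē`, `−4 < μ − ē`, `μ + ē < 0`),
then along the ray of angle `θ` it vanishes outside `t ∈ (u_{μ−ē}(θ), u_{μ+ē}(θ))`. -/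
theorem klry_band_ray_support {h : ℝ × ℝ → E} {μ ē : ℝ} (hē : 0 ≤ ē) (hlo : -4 < μ - ē) (hhi : μ + ē < 0)
    (hsupp : ∀ p : ℝ × ℝ, h p ≠ 0 → |p.1| < π ∧ |p.2| < π ∧ |sqDispersion ![p.1, p.2] - μ| < ē)
    {θ t : ℝ} (ht : 0 < t) (hnot : t ∉ Ioo (bandFermiRadius (μ - ē) θ) (bandFermiRadius (μ + ē) θ)) :
    h (t * Real.cos θ, t * Real.sin θ) = 0 := by
  by_contra hne
  obtain ⟨h1, h2, h3⟩ := hsupp _ hne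
  rw [klry_sqDispersion_ray] at h3
  have htI : t ∈ Icc 0 (π / ‖dir θ‖) := klry_mem_Icc_exit ht.le h1 h2
  have hmono := strictMonoOn_rayDispersion_band θ
  have hm : IsBandFermiRadius (μ - ē) θ (bandFermiRadius (μ - ē) θ) :=
    isBandFermiRadius_bandFermiRadius hlo (by linarith) θ
  have hp : IsBandFermiRadius (μ + ē) θ (bandFermiRadius (μ + ē) θ) :=
    isBandFermiRadius_bandFermiRadius (by linarith) hhi θ
  have h3' := abs_lt.mp h3
  apply hnot
  constructor
  · have hlt : rayDispersion (θ, bandFermiRadius (μ - ē) θ) < rayDispersion (θ, t) := by rw [hm.2]; linarith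
    exact (hmono.lt_iff_lt hm.mem_Icc htI).mp hlt
  · have hlt : rayDispersion (θ, t) < rayDispersion (θ, bandFermiRadius (μ + ē) θ) := by rw [hp.2]; linarith
    exact (hmono.lt_iff_lt htI hp.mem_Icc).mp hlt

/-- The band Fermi radius is monotone in the level (from the strict monotonicity of the ray dispersion). -/
theorem klry_bandFermiRadius_level_mono {ν ν' : ℝ} (hν : -4 < ν) (hνν' : ν ≤ ν') (hν' : ν' < 0) (θ : ℝ) :
    bandFermiRadius ν θ ≤ bandFermiRadius ν' θ := by
  have hm : IsBandFermiRadius ν θ (bandFermiRadius ν θ) := isBandFermiRadius_bandFermiRadius hν (by linarith) θ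
  have hp : IsBandFermiRadius ν' θ (bandFermiRadius ν' θ) := isBandFermiRadius_bandFermiRadius (by linarith) hν' θ
  have hmono := strictMonoOn_rayDispersion_band θ
  rw [← hmono.le_iff_le hm.mem_Icc hp.mem_Icc, hm.2, hp.2]
  exact hνν'

/-- `e ↦ u_{μ+e}(θ)` is continuous at every `e` with `−4 < μ + e < 0` (joint smoothness of `(ν, θ) ↦ u_ν(θ)`). -/
theorem klry_continuousAt_bandFermiRadius_level {μ e : ℝ} (h1 : -4 < μ + e) (h2 : μ + e < 0) (θ : ℝ) :
    ContinuousAt (fun e : ℝ => bandFermiRadius (μ + e) θ) e := by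
  have hA : ContinuousAt (fun p : ℝ × ℝ => bandFermiRadius p.1 p.2) (μ + e, θ) :=
    (contDiffAt_bandFermiRadius_uncurry h1 h2 (n := 0)).continuousAt
  have hB : Continuous (fun e : ℝ => ((μ + e, θ) : ℝ × ℝ)) := by fun_prop
  exact ContinuousAt.comp (f := fun e : ℝ => ((μ + e, θ) : ℝ × ℝ)) (x := e) hA hB.continuousAt

/-- **The level derivative of the ray reparametrisation**: `∂_e u_{μ+e}(θ) = 1/∂_tε(θ, u_{μ+e}(θ))` (`−4 < μ + e < 0`). -/
theorem klry_hasDerivAt_bandFermiRadius_level {μ e : ℝ} (h1 : -4 < μ + e) (h2 : μ + e < 0) (θ : ℝ) :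
    HasDerivAt (fun e : ℝ => bandFermiRadius (μ + e) θ) (1 / rayDispersionDt θ (bandFermiRadius (μ + e) θ)) e := by
  have hd := hasDerivAt_bandFermiRadius_level h1 h2 θ
  have h2' : HasDerivAt (fun e : ℝ => μ + e) 1 e := by simpa using (hasDerivAt_id e).const_add μ
  have := hd.comp e h2'
  rw [mul_one] at this
  exact this

/-- The Jacobian factor `e ↦ 1/∂_tε(θ, u_{μ+e}(θ))` is continuous on `[−ē, ē]` (`−4 < μ − ē`, `μ + ē < 0`). -/
theorem klry_continuousOn_invDt {μ ē : ℝ} (hlo : -4 < μ - ē) (hhi : μ + ē < 0) (θ : ℝ) :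
    ContinuousOn (fun e : ℝ => 1 / rayDispersionDt θ (bandFermiRadius (μ + e) θ)) (Icc (-ē) ē) := by
  have hDt : ContinuousOn (fun e : ℝ => rayDispersionDt θ (bandFermiRadius (μ + e) θ)) (Icc (-ē) ē) := by
    intro e he
    have h1 : -4 < μ + e := by linarith [he.1]
    have h2 : μ + e < 0 := by linarith [he.2]
    have hA : ContinuousAt (fun p : ℝ × ℝ => rayDispersionDt p.1 p.2) (θ, bandFermiRadius (μ + e) θ) :=
      continuous_rayDispersionDt.continuousAt
    have hB : ContinuousAt (fun e : ℝ => ((θ, bandFermiRadius (μ + e) θ) : ℝ × ℝ)) e :=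
      continuousAt_const.prodMk (klry_continuousAt_bandFermiRadius_level h1 h2 θ)
    exact (ContinuousAt.comp (f := fun e : ℝ => ((θ, bandFermiRadius (μ + e) θ) : ℝ × ℝ)) (x := e) hA hB).continuousWithinAt
  refine continuousOn_const.div hDt fun e he => ?_
  exact (rayDispersionDt_bandFermiRadius_pos (by linarith [he.1]) (by linarith [he.2]) θ).ne'

/-- **The planar integral over the band tube in level coordinates.**  For `h : ℝ × ℝ → E` continuous with compact support, supported in the
open square `(−π,π)²` and in the tube `|ε − μ| < ē` of the bare band (`0 ≤ ē`, `−4 < μ − ē`, `μ + ē < 0`):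
`∫ h = ∫_{θ ∈ (−π,π)} ∫_{e ∈ −ē..ē} (u_{μ+e}(θ)·(1/∂_tε(θ,u_{μ+e}(θ)))) • h(u_{μ+e}(θ) cos θ, u_{μ+e}(θ) sin θ) de dθ`. -/
theorem klry_integral_eq_band_level_coords {h : ℝ × ℝ → E} (hc : Continuous h) (hcs : HasCompactSupport h)
    {μ ē : ℝ} (hē : 0 ≤ ē) (hlo : -4 < μ - ē) (hhi : μ + ē < 0)
    (hsupp : ∀ p : ℝ × ℝ, h p ≠ 0 → |p.1| < π ∧ |p.2| < π ∧ |sqDispersion ![p.1, p.2] - μ| < ē) :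
    ∫ p, h p = ∫ θ in Ioo (-π) π, ∫ e in (-ē)..ē,
      (bandFermiRadius (μ + e) θ * (1 / rayDispersionDt θ (bandFermiRadius (μ + e) θ))) •
        h (bandFermiRadius (μ + e) θ * Real.cos θ, bandFermiRadius (μ + e) θ * Real.sin θ) := by
  have hneg : μ + -ē = μ - ē := by ring
  refine klry_integral_eq_polar_ray hc hcs hē (ρ := fun θ e => bandFermiRadius (μ + e) θ)
    (ρₑ := fun θ e => 1 / rayDispersionDt θ (bandFermiRadius (μ + e) θ)) ?_ ?_ ?_ ?_ ?_
  · intro θ _ e he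
    exact klry_hasDerivAt_bandFermiRadius_level (by linarith [he.1]) (by linarith [he.2]) θ
  · intro θ _
    exact klry_continuousOn_invDt hlo hhi θ
  · intro θ _
    simp only [hneg]
    exact bandFermiRadius_pos hlo (by linarith) θ
  · intro θ _
    simp only [hneg]
    exact klry_bandFermiRadius_level_mono hlo (by linarith) hhi θ
  · intro θ _ t ht hnot
    refine klry_band_ray_support hē hlo hhi hsupp ht ?_
    simpa only [hneg] using hnot

/-- **Radial integrands in level coordinates.**  If moreover `h(t cos θ, t sin θ) = H θ (ε(t·dir θ) − μ)` for `t > 0` (a function of the angle and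
of the band energy only — the shape of the slice propagators and cutoffs), then
`∫ h = ∫_{θ ∈ (−π,π)} ∫_{e ∈ −ē..ē} (u_{μ+e}(θ)·(1/∂_tε(θ,u_{μ+e}(θ)))) • H θ e de dθ` — the `(θ, e)` form consumed by the `klte_*` / `klsp_*`
estimates (with `k₀` riding along inside `H`). -/
theorem klry_integral_eq_band_level_coords_radial {h : ℝ × ℝ → E} (hc : Continuous h) (hcs : HasCompactSupport h)
    {μ ē : ℝ} (hē : 0 ≤ ē) (hlo : -4 < μ - ē) (hhi : μ + ē < 0)
    (hsupp : ∀ p : ℝ × ℝ, h p ≠ 0 → |p.1| < π ∧ |p.2| < π ∧ |sqDispersion ![p.1, p.2] - μ| < ē)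
    {H : ℝ → ℝ → E} (hfac : ∀ θ ∈ Ioo (-π) π, ∀ t, 0 < t → h (t * Real.cos θ, t * Real.sin θ) = H θ (rayDispersion (θ, t) - μ)) :
    ∫ p, h p = ∫ θ in Ioo (-π) π, ∫ e in (-ē)..ē,
      (bandFermiRadius (μ + e) θ * (1 / rayDispersionDt θ (bandFermiRadius (μ + e) θ))) • H θ e := by
  have hneg : μ + -ē = μ - ē := by ring
  refine klry_integral_eq_polar_ray_level hc hcs hē (ρ := fun θ e => bandFermiRadius (μ + e) θ)
    (ρₑ := fun θ e => 1 / rayDispersionDt θ (bandFermiRadius (μ + e) θ)) (eOf := fun θ t => rayDispersion (θ, t) - μ) (H := H)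
    ?_ ?_ ?_ ?_ ?_ hfac ?_
  · intro θ _ e he
    exact klry_hasDerivAt_bandFermiRadius_level (by linarith [he.1]) (by linarith [he.2]) θ
  · intro θ _
    exact klry_continuousOn_invDt hlo hhi θ
  · intro θ _ e he
    exact bandFermiRadius_pos (by linarith [he.1]) (by linarith [he.2]) θ
  · intro θ _
    simp only [hneg]
    exact klry_bandFermiRadius_level_mono hlo (by linarith) hhi θ
  · intro θ _ t ht hnot
    refine klry_band_ray_support hē hlo hhi hsupp ht ?_
    simpa only [hneg] using hnot
  · intro θ _ e he
    show rayDispersion (θ, bandFermiRadius (μ + e) θ) - μ = e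
    rw [rayDispersion_bandFermiRadius (by linarith [he.1]) (by linarith [he.2]) θ]
    ring

end Summit.HubbardSuperconductivity.HubbardSuperconductivity.Theorems.KLRegimeSplit

end
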